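import Summits.MatrixMultiplication.OmegaCensus.DominoZpZpKit
import HarnessLib

/-!
# Margin-pruned kernel enumeration of multisets on `ZMod p × ZMod p` (generic in `p`): the programs and their specs

ω-census `pub-omega`, family (b3), seat pub-omega-group gen 20.  Framing: lottery ticket; floor = certified bounds/negative
ranges.  VALUE: the generic enumerator behind the `ℤ_p × ℤ_p` domino cell theorems; NOT progress on ω.

Goal (per `(p, d)` and certified table `T`): every value function `g : Fin (p²) → ℕ` of sum `d` in `GL₂` normal form has a
direction `j ≤ p` whose count vector `(Σ_{pv p j i = v} g i)_v` is the key of an entry of `T`.  The kernel program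
(`coverGen`) enumerates the ROW-SUM vector `R` first (direction `0`); if the code `polyBE B R` is not flagged as "uncertified" by
the search tree `tree` the whole class of matrices with row sums `R` is covered at once; otherwise the matrices are
enumerated ROW BY ROW, each row drawn from a precomputed list of compositions of `R[t]` (`compsLB`, with the normal-form
lower bounds), the `p + 1` direction codes being ACCUMULATED (`addRow`, cell weights `rowWs p B`); a leaf passes if some code
is not flagged.  Here: the programs (`rowsEnum`, `coverGen`, `coverNF1/2/3`, `soundChk`), their list-level specifications and
the code bookkeeping (`getD_accsAfter`); the semantic statement is `DominoZpZpCover.exists_entry_of_cover`.  The only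
trusted fact about `tree` is the extensional check `soundChk` (decided per table).  Sizes: `pub-omega-group-g20/code/`.
-/

namespace Summit.MatrixMultiplication.OmegaCensus

open Finset

namespace ZpZpDomino

/-! ## The enumerator -/

/-- `accs + v·w`, pointwise. [folklore] -/
def addMul (accs : List ℕ) (v : ℕ) (w : List ℕ) : List ℕ := List.zipWith (fun a x => a + v * x) accs w

/-- Add a row of values (cell weights `w`) to the accumulated codes. [folklore] -/
def addRow : List (List ℕ) → List ℕ → List ℕ → List ℕ
  | x :: w, accs, v :: row => addRow w (if v = 0 then accs else addMul accs v x) row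
  | _, accs, _ => accs

/-- The row enumerator: remaining rows' cell weights, remaining rows' candidate lists, accumulated codes; a leaf passes
if some accumulated code is NOT flagged by `tree`. [folklore] -/
def rowsEnum (tree : BTree) : List (List (List ℕ)) → List (List (List ℕ)) → List ℕ → Bool
  | w :: ws, cs :: css, accs => cs.all fun row => rowsEnum tree ws css (addRow w accs row)
  | _, _, accs => accs.any fun a => !(tree.mem a)

/-- Accumulated codes after adding the rows of `M` (the functional description of `rowsEnum`'s leaves). [folklore] -/
def accsAfter : List (List (List ℕ)) → List ℕ → List (List ℕ) → List ℕ
  | w :: ws, accs, row :: M => accsAfter ws (addRow w accs row) M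
  | _, accs, _ => accs

/-- **Specification of the row enumerator.** [folklore] -/
theorem rowsEnum_spec (tree : BTree) : ∀ (ws css : List (List (List ℕ))) (accs : List ℕ),
    rowsEnum tree ws css accs = true → ws.length = css.length →
    ∀ M : List (List ℕ), M.length = css.length → (∀ t < css.length, M.getD t [] ∈ css.getD t []) →
    (accsAfter ws accs M).any (fun a => !(tree.mem a)) = true
  | [], [], accs, h, _, M, hM, _ => by
    have hM' : M = [] := List.eq_nil_of_length_eq_zero hM
    subst hM'
    simpa [rowsEnum, accsAfter] using h
  | [], _ :: _, _, _, hl, _, _, _ => by simp at hl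
  | _ :: _, [], _, _, hl, _, _, _ => by simp at hl
  | w :: ws, cs :: css, accs, h, hl, M, hM, hmem => by
    obtain ⟨row, M', rfl⟩ := List.exists_cons_of_length_eq_add_one hM
    simp only [rowsEnum, List.all_eq_true] at h
    have h0 := hmem 0 (by simp)
    simp only [List.getD_cons_zero] at h0
    simp only [List.length_cons, Nat.add_right_cancel_iff] at hl hM
    simp only [accsAfter]
    exact rowsEnum_spec tree ws css _ (h row h0) hl M' hM fun t ht => by
      simpa using hmem (t + 1) (by simpa using ht)

/-- **The cover program**: for every candidate row-sum vector `R`, either its code is unflagged or the row enumeration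
(row `t` drawn from `tabs[t][R[t]]`) passes. [folklore] -/
def coverGen (tree : BTree) (B : ℕ) (ws : List (List (List ℕ))) (Rlist : List (List ℕ))
    (tabs : List (List (List (List ℕ)))) (init : List ℕ) : Bool :=
  Rlist.all fun R =>
    !(tree.mem (polyBE B R)) || rowsEnum tree ws (List.zipWith (fun tab r => tab.getD r []) tabs R) init

/-- **Specification of the cover program.** [folklore] -/
theorem coverGen_spec {tree : BTree} {B : ℕ} {ws : List (List (List ℕ))} {Rlist : List (List ℕ)}
    {tabs : List (List (List (List ℕ)))} {init : List ℕ} (h : coverGen tree B ws Rlist tabs init = true)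
    (hl : ws.length = tabs.length) (R : List ℕ) (hR : R ∈ Rlist) (hRl : R.length = tabs.length) :
    tree.mem (polyBE B R) = false ∨
      ∀ M : List (List ℕ), M.length = R.length →
        (∀ t < R.length, M.getD t [] ∈ (tabs.getD t []).getD (R.getD t 0) []) →
        (accsAfter ws init M).any (fun a => !(tree.mem a)) = true := by
  simp only [coverGen, List.all_eq_true] at h
  have hR' := h R hR
  rcases Bool.or_eq_true_iff.1 hR' with h1 | h2
  · left; simpa using h1
  · right
    intro M hM hmem
    have hlen : (List.zipWith (fun tab r => tab.getD r []) tabs R).length = R.length := by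
      rw [List.length_zipWith, hRl, Nat.min_self]
    refine rowsEnum_spec tree ws _ init h2 (by rw [hlen, hl, hRl]) M (by rw [hlen, hM]) fun t ht => ?_
    rw [hlen] at ht
    have e : (List.zipWith (fun tab r => tab.getD r []) tabs R).getD t [] = (tabs.getD t []).getD (R.getD t 0) [] := by
      rw [List.getD_eq_getElem?_getD, List.getElem?_zipWith, List.getElem?_eq_getElem (by rw [← hRl]; exact ht),
        List.getElem?_eq_getElem ht]
      simp [List.getD_eq_getElem?_getD, List.getElem?_eq_getElem (show t < tabs.length by rw [← hRl]; exact ht),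
        List.getElem?_eq_getElem ht]
    rw [e]
    exact hmem t ht

/-! ## Compositions with lower bounds -/

/-- All lists of length `n` and sum `r` with `l[k] ≥ lb[k]` (missing bounds are `0`). [folklore] -/
def compsLB : List ℕ → ℕ → ℕ → List (List ℕ)
  | _, 0, r => if r = 0 then [[]] else []
  | lb, n + 1, r => (List.range (r + 1 - lb.headD 0)).flatMap fun c =>
      (compsLB lb.tail n (r - (c + lb.headD 0))).map fun l => (c + lb.headD 0) :: l

/-- **Completeness of `compsLB`.** [folklore] -/
theorem mem_compsLB : ∀ (lb : List ℕ) (n r : ℕ) (l : List ℕ), l.length = n → l.sum = r →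
    (∀ k < n, lb.getD k 0 ≤ l.getD k 0) → l ∈ compsLB lb n r
  | lb, 0, r, l, hl, hs, _ => by
    have hl' : l = [] := List.eq_nil_of_length_eq_zero hl
    subst hl'
    simp only [List.sum_nil] at hs
    subst hs
    simp [compsLB]
  | lb, n + 1, r, l, hl, hs, hb => by
    obtain ⟨a, l', rfl⟩ := List.exists_cons_of_length_eq_add_one hl
    simp only [List.length_cons, Nat.add_right_cancel_iff] at hl
    simp only [List.sum_cons] at hs
    have h0 := hb 0 (by omega)
    have e0 : lb.getD 0 0 = lb.headD 0 := by cases lb <;> rfl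
    simp only [List.getD_cons_zero, e0] at h0
    simp only [compsLB, List.mem_flatMap, List.mem_range, List.mem_map]
    refine ⟨a - lb.headD 0, by omega, l', ?_, by rw [Nat.sub_add_cancel h0]⟩
    refine mem_compsLB lb.tail n _ l' hl (by omega) fun k hk => ?_
    have h1 := hb (k + 1) (by omega)
    have e1 : lb.getD (k + 1) 0 = lb.tail.getD k 0 := by cases lb <;> simp
    simpa [e1] using h1

/-- Composition tables indexed by the row sum `r ≤ d`. [folklore] -/
def tabOf (lb : List ℕ) (p d : ℕ) : List (List (List ℕ)) := (List.range (d + 1)).map fun r => compsLB lb p r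

/-- The forced rows of the axis normal forms: row `t` is `[r, 0, …, 0]`. [folklore] -/
def tabAxis (p d : ℕ) : List (List (List ℕ)) := (List.range (d + 1)).map fun r => [r :: List.replicate (p - 1) 0]

/-- Entries of `tabOf`. [folklore] -/
theorem getD_tabOf (lb : List ℕ) (p d : ℕ) {r : ℕ} (hr : r < d + 1) : (tabOf lb p d).getD r [] = compsLB lb p r := by
  simp [tabOf, List.getD_eq_getElem?_getD, List.getElem?_range hr]

/-- Entries of `tabAxis`. [folklore] -/
theorem getD_tabAxis (p d : ℕ) {r : ℕ} (hr : r < d + 1) :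
    (tabAxis p d).getD r [] = [r :: List.replicate (p - 1) 0] := by
  simp [tabAxis, List.getD_eq_getElem?_getD, List.getElem?_range hr]

/-- **Table soundness check** (a `Bool`, kernel-friendly): every composition of `d` into `p` parts whose code is NOT
flagged by `tree` is the key of an entry of `T`. [folklore] -/
def soundChk (p d : ℕ) (tree : BTree) (T : List (List ℕ × List (ℕ × List ℕ))) : Bool :=
  (compsLB [] p d).all fun c => tree.mem (polyBE (d + 1) c) || T.any fun e => e.1 == c

/-- From the `Bool` check to the hypothesis `hT` of `exists_entry_of_cover`. [folklore] -/
theorem sound_of_soundChk {p d : ℕ} {tree : BTree} {T : List (List ℕ × List (ℕ × List ℕ))}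
    (h : soundChk p d tree T = true) :
    ∀ c ∈ compsLB [] p d, tree.mem (polyBE (d + 1) c) = false → ∃ e ∈ T, e.1 = c := by
  intro c hc hm
  simp only [soundChk, List.all_eq_true] at h
  have h1 := h c hc
  rw [hm, Bool.false_or, List.any_eq_true] at h1
  obtain ⟨e, he, hee⟩ := h1
  exact ⟨e, he, by simpa using hee⟩

/-! ## The three normal-form cover programs (chunked by a residue of the row-sum code) -/

/-- Cover program, normal form (i) (`g(1,0), g(0,1) ≥ 1`), chunk `k` of `m` (chunk key `polyBE K R % m`). [folklore] -/
def coverNF1 (p d : ℕ) (tree : BTree) (K m k : ℕ) : Bool :=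
  coverGen tree (d + 1) (rowWs p (d + 1)) ((compsLB [1, 1] p d).filter fun R => polyBE K R % m = k)
    ([tabOf [0, 1] p d, tabOf [1] p d] ++ List.replicate (p - 2) (tabOf [] p d)) (List.replicate (p + 1) 0)

/-- Cover program, normal form (ii) (`g(1,0) ≥ 1`, support on the axis `u₂ = 0`). [folklore] -/
def coverNF2 (p d : ℕ) (tree : BTree) : Bool :=
  coverGen tree (d + 1) (rowWs p (d + 1)) (compsLB [0, 1] p d) (List.replicate p (tabAxis p d))
    (List.replicate (p + 1) 0)

/-- Cover program, normal form (iii) (`g` supported at `0`). [folklore] -/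
def coverNF3 (p d : ℕ) (tree : BTree) : Bool :=
  coverGen tree (d + 1) (rowWs p (d + 1)) [d :: List.replicate (p - 1) 0] (List.replicate p (tabAxis p d))
    (List.replicate (p + 1) 0)

/-- A single chunk: `m = 1`. [folklore] -/
theorem forall_lt_one {P : ℕ → Prop} (h : P 0) : ∀ k < 1, P k := fun k hk => by
  obtain rfl : k = 0 := by omega
  exact h

/-! ## Codes of the accumulated rows -/

/-- Length of `addMul`. [folklore] -/
theorem length_addMul (accs : List ℕ) (v : ℕ) (x : List ℕ) (hx : x.length = accs.length) :
    (addMul accs v x).length = accs.length := by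
  simp [addMul, List.length_zipWith, hx]

/-- Entries of `addMul`. [folklore] -/
theorem getD_addMul (accs : List ℕ) (v : ℕ) (x : List ℕ) (hx : x.length = accs.length) {j : ℕ}
    (hj : j < accs.length) : (addMul accs v x).getD j 0 = accs.getD j 0 + v * x.getD j 0 := by
  have hj' : j < x.length := by rw [hx]; exact hj
  simp [addMul, List.getD_eq_getElem?_getD, List.getElem?_zipWith, List.getElem?_eq_getElem hj,
    List.getElem?_eq_getElem hj']

/-- Length of `addRow`. [folklore] -/
theorem length_addRow : ∀ (w : List (List ℕ)) (accs row : List ℕ), (∀ x ∈ w, x.length = accs.length) →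
    (addRow w accs row).length = accs.length
  | [], accs, row, _ => by cases row <;> rfl
  | x :: w, accs, [], _ => rfl
  | x :: w, accs, v :: row, hw => by
    have hx : x.length = accs.length := hw x (by simp)
    simp only [addRow]
    split_ifs with hv
    · exact length_addRow w accs row fun y hy => hw y (by simp [hy])
    · rw [length_addRow w _ row fun y hy => by rw [length_addMul _ _ _ hx]; exact hw y (by simp [hy]),
        length_addMul _ _ _ hx]

/-- Entries of `addRow`: the accumulated code of direction `j`. [folklore] -/
theorem getD_addRow : ∀ (w : List (List ℕ)) (accs row : List ℕ), (∀ x ∈ w, x.length = accs.length) →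
    w.length = row.length → ∀ {j : ℕ}, j < accs.length →
    (addRow w accs row).getD j 0 = accs.getD j 0 + ∑ u ∈ range row.length, row.getD u 0 * (w.getD u []).getD j 0
  | [], accs, [], _, _, j, _ => by simp [addRow]
  | [], _, _ :: _, _, hl, _, _ => by simp at hl
  | _ :: _, _, [], _, hl, _, _ => by simp at hl
  | x :: w, accs, v :: row, hw, hl, j, hj => by
    have hx : x.length = accs.length := hw x (by simp)
    simp only [List.length_cons, Nat.add_right_cancel_iff] at hl
    simp only [addRow]
    rw [List.length_cons, sum_range_succ', List.getD_cons_zero, List.getD_cons_zero]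
    simp only [List.getD_cons_succ]
    split_ifs with hv
    · rw [getD_addRow w accs row (fun y hy => hw y (by simp [hy])) hl hj, hv]
      ring
    · have hw' : ∀ y ∈ w, y.length = (addMul accs v x).length := fun y hy => by
        rw [length_addMul _ _ _ hx]; exact hw y (by simp [hy])
      rw [getD_addRow w _ row hw' hl (by rw [length_addMul _ _ _ hx]; exact hj), getD_addMul _ _ _ hx hj]
      ring

/-- Length of `accsAfter`. [folklore] -/
theorem length_accsAfter : ∀ (ws : List (List (List ℕ))) (accs : List ℕ) (M : List (List ℕ)),
    (∀ w ∈ ws, ∀ x ∈ w, x.length = accs.length) → (accsAfter ws accs M).length = accs.length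
  | [], accs, M, _ => by cases M <;> rfl
  | w :: ws, accs, [], _ => rfl
  | w :: ws, accs, row :: M, hws => by
    simp only [accsAfter]
    have h1 : (addRow w accs row).length = accs.length := length_addRow w accs row (hws w (by simp))
    rw [length_accsAfter ws _ M fun w' hw' x hx => by rw [h1]; exact hws w' (by simp [hw']) x hx, h1]

/-- Entries of `accsAfter`: the code of direction `j` is the double sum over rows and cells. [folklore] -/
theorem getD_accsAfter : ∀ (ws : List (List (List ℕ))) (accs : List ℕ) (M : List (List ℕ)),
    (∀ w ∈ ws, ∀ x ∈ w, x.length = accs.length) → ws.length = M.length →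
    (∀ t < M.length, (ws.getD t []).length = (M.getD t []).length) → ∀ {j : ℕ}, j < accs.length →
    (accsAfter ws accs M).getD j 0 = accs.getD j 0 +
      ∑ t ∈ range M.length, ∑ u ∈ range (M.getD t []).length,
        (M.getD t []).getD u 0 * ((ws.getD t []).getD u []).getD j 0
  | [], accs, [], _, _, _, j, _ => by simp [accsAfter]
  | [], _, _ :: _, _, hl, _, _, _ => by simp at hl
  | _ :: _, _, [], _, hl, _, _, _ => by simp at hl
  | w :: ws, accs, row :: M, hws, hl, hwl, j, hj => by
    simp only [List.length_cons, Nat.add_right_cancel_iff] at hl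
    have hw : ∀ x ∈ w, x.length = accs.length := hws w (by simp)
    have h1 : (addRow w accs row).length = accs.length := length_addRow w accs row hw
    have h0 := hwl 0 (by simp)
    simp only [List.getD_cons_zero] at h0
    simp only [accsAfter]
    rw [getD_accsAfter ws _ M (fun w' hw' x hx => by rw [h1]; exact hws w' (by simp [hw']) x hx) hl
      (fun t ht => by simpa using hwl (t + 1) (by simpa using ht)) (by rw [h1]; exact hj),
      getD_addRow w accs row hw h0 hj, List.length_cons, sum_range_succ']
    simp only [List.getD_cons_zero, List.getD_cons_succ]
    ring

end ZpZpDomino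

end Summit.MatrixMultiplication.OmegaCensus
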